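import Summits.PneNP.PneNP.Theorems.ExpanderLinearGeneratorsSteeredWalks

/-!
# Boundaryless scope families contain small over-shared subfamilies ("three lassos")

Second helper file for the `ℓ = 8` locality floor of item stmt-PneNP-11443
(`Summit.PneNP.PneNP.Theses.ExpanderLinearGenerators.LinearGeneratorDepthFregeHard`), on top
of `ExpanderLinearGeneratorsSteeredWalks.lean`.

Setting: scopes `S : ι → Finset ℕ` and a nonempty index set `J` with EMPTY boundary (every point
of a scope of `J` lies in a second scope of `J`) whose scopes have `≥ 3` points. We show that `J`
contains a subfamily `F` of only `6 t + 1` indices, `|cover J| < 2^t`, which is OVER-SHARED: the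
points of `F`-degree `≥ 2` absorb more than `2 |F|` incidences,
`∑_{w : deg_F w ≥ 2} deg_F w ≥ 2 |F| + 1` (`exists_overShared_of_boundary_eq_empty`).
(Unique-neighbour expansion `|∂F| ≥ (3/4) ℓ |F|` with scopes of size `≤ ℓ ≤ 8` forces the
opposite inequality for `|F| ≤ r`; that contradiction is drawn in
`ExpanderLinearGeneratorsLinearGeneratorDepthFregeHardLocalityEight.lean`.)

Proof (walk counting). Fix `j ∈ J` and a point `v ∈ S j`. The `2^t` steered walks of length `t`
through `(j, v)` (`LassoKit.st`) end in `cover J`, so two of them, steered by `b ≠ b'`, end at the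
same point; they separate right after the first differing bit and first re-merge at a node
entered through two different incidences, where the incidences of the two walks up to that node
form a lasso with at most `2 t` indices besides `j` (`LassoKit.exists_lasso`). The union of
three lassos through three points of `S j` has all degrees `≠ 1` and degree `≥ 3` at `j`; double
counting its incidences by indices and by points shows that its index set is over-shared
(`overShared_of_companions`, `overShared_of_three_lassos`).

References: folklore (Moore bound / two short cycles in graphs of minimum degree `3`); boundary
and cover as in E. Ben-Sasson, A. Wigderson, J. ACM 48 (2001) §5 [BenSassonWigderson2001].
-/

namespace Summit.PneNP.PneNP.Theorems

set_option linter.dupNamespace false -- `Summit.PneNP.PneNP.…`: summit = sub-problem (D-0017)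

open Finset Literature.Computability.MetaComplexity

section Lasso

variable {ι : Type*} [DecidableEq ι] {S : ι → Finset ℕ} {J : Finset ι}

namespace LassoKit

variable (K : LassoKit S J) {j : ι} {v : ℕ}

/-- The indices visited by a walk up to time `t`, other than the start. [folklore] -/
def rows (j : ι) (v : ℕ) (b : ℕ → Bool) (t : ℕ) : Finset ι :=
  (range t).image fun k => (K.st j v b (k + 1)).1

/-- A walk visits at most `t` indices up to time `t` besides the start. [folklore] -/
theorem card_rows_le (b : ℕ → Bool) (t : ℕ) : (K.rows j v b t).card ≤ t :=
  Finset.card_image_le.trans (by simp)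

/-- The index occupied at time `k ≤ t` is the start or a visited index. [folklore] -/
theorem fst_st_mem_insert_rows {b : ℕ → Bool} {t k : ℕ} (hk : k ≤ t) :
    (K.st j v b k).1 ∈ insert j (K.rows j v b t) := by
  cases k with
  | zero => exact Finset.mem_insert_self _ _
  | succ k =>
    exact Finset.mem_insert_of_mem (Finset.mem_image.2 ⟨k, Finset.mem_range.2 (by omega), rfl⟩)

/-- Indices of a point-truncated walk. [folklore] -/
theorem image_fst_edgesV_subset {b : ℕ → Bool} {n t : ℕ} (hn : n ≤ t) :
    (K.edgesV j v b n).image Prod.fst ⊆ insert j (K.rows j v b t) := by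
  intro i hi
  obtain ⟨e, he, rfl⟩ := Finset.mem_image.1 hi
  rcases (K.mem_edgesV).1 he with ⟨k, hk, rfl⟩ | ⟨k, hk, rfl⟩
  · exact K.fst_st_mem_insert_rows (hk.trans hn)
  · exact K.fst_st_mem_insert_rows (by omega)

/-- Indices of an index-truncated walk. [folklore] -/
theorem image_fst_edgesR_subset {b : ℕ → Bool} {n t : ℕ} (hn : n ≤ t) :
    (K.edgesR j v b n).image Prod.fst ⊆ insert j (K.rows j v b t) := by
  intro i hi
  obtain ⟨e, he, rfl⟩ := Finset.mem_image.1 hi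
  rcases (K.mem_edgesR).1 he with ⟨k, hk, rfl⟩ | ⟨k, hk, rfl⟩
  · exact K.fst_st_mem_insert_rows (by omega)
  · exact K.fst_st_mem_insert_rows (by omega)

/-- **Existence of small lassos** (walk counting). If `|cover J| < 2^t` then through every
incidence `(j, v)` of `J` there is a lasso using, besides `j`, at most `2 t` indices: two of the
`2^t` steered walks of length `t` end at the same point, and their incidences up to the first
re-merge after the first differing bit form the lasso. [folklore] -/
theorem exists_lasso (K : LassoKit S J) (hj : j ∈ J) (hv : v ∈ S j) {t : ℕ}
    (ht : (cover S J).card < 2 ^ t) :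
    ∃ L : Lasso S J j v, ∃ T : Finset ι, L.U.image Prod.fst ⊆ insert j T ∧ T.card ≤ 2 * t := by
  classical
  -- the steering bit strings and the end-point map
  let ext : (Fin t → Bool) → ℕ → Bool := fun c k => if h : k < t then c ⟨k, h⟩ else false
  have hmaps : ∀ c ∈ (Finset.univ : Finset (Fin t → Bool)),
      (K.st j v (ext c) t).2 ∈ cover S J := fun c _ =>
    mem_cover.2 ⟨_, K.fst_mem hj hv _ t, (K.st_mem hj hv _ t).2⟩
  have hcard : (cover S J).card < (Finset.univ : Finset (Fin t → Bool)).card := by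
    simpa [Fintype.card_fun] using ht
  obtain ⟨c, -, c', -, hcc, hend⟩ := Finset.exists_ne_map_eq_of_card_lt_of_maps_to hcard hmaps
  set b := ext c with hb
  set b' := ext c' with hb'
  -- the first differing bit `k₀ < t`
  have hex : ∃ k, b k ≠ b' k := by
    obtain ⟨i, hi⟩ := Function.ne_iff.1 hcc
    exact ⟨i, by simpa [hb, hb', ext, i.2] using hi⟩
  let k₀ := Nat.find hex
  have hk₀ : b k₀ ≠ b' k₀ := Nat.find_spec hex
  have hagree : ∀ l < k₀, b l = b' l := fun l hl => by
    have := Nat.find_min hex hl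
    tauto
  have hk₀t : k₀ < t := by
    by_contra h
    exact hk₀ (by simp [hb, hb', ext, h])
  obtain ⟨hrow₁, hpt₁⟩ := K.split_step hj hv hagree hk₀
  -- the first re-merge `s₁ ≤ t` after time `k₀ + 1`
  have hk1t : k₀ + 1 < t := by
    rcases Nat.lt_or_ge (k₀ + 1) t with h | h
    · exact h
    · exfalso
      have : k₀ + 1 = t := by omega
      rw [← this] at hend
      exact hpt₁ hend
  have hmerge : ∃ s, k₀ + 1 < s ∧
      ((K.st j v b s).1 = (K.st j v b' s).1 ∨ (K.st j v b s).2 = (K.st j v b' s).2) :=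
    ⟨t, hk1t, Or.inr hend⟩
  obtain ⟨hs₁, hms₁⟩ := Nat.find_spec hmerge
  have hs₁t : Nat.find hmerge ≤ t := Nat.find_min' hmerge ⟨hk1t, Or.inr hend⟩
  have hmin : ∀ s, k₀ + 1 < s → s < Nat.find hmerge →
      (K.st j v b s).1 ≠ (K.st j v b' s).1 ∧ (K.st j v b s).2 ≠ (K.st j v b' s).2 := by
    intro s hs hss
    have := Nat.find_min hmerge hss
    tauto
  generalize Nat.find hmerge = s₁ at hs₁ hms₁ hs₁t hmin
  -- the size witness
  let T : Finset ι := K.rows j v b t ∪ K.rows j v b' t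
  have hT : T.card ≤ 2 * t :=
    (Finset.card_union_le _ _).trans (by
      have h1 := K.card_rows_le (j := j) (v := v) b t
      have h2 := K.card_rows_le (j := j) (v := v) b' t
      omega)
  by_cases hcase : (K.st j v b s₁).1 = (K.st j v b' s₁).1
  · -- merge at an index: `s₁ = m + 1`, entered from different points
    obtain ⟨m, rfl⟩ : ∃ m, s₁ = m + 1 := ⟨s₁ - 1, by omega⟩
    have hptm : (K.st j v b m).2 ≠ (K.st j v b' m).2 := by
      rcases Nat.lt_or_ge (k₀ + 1) m with h | h
      · exact (hmin m h (Nat.lt_succ_self m)).2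
      · have : m = k₀ + 1 := by omega
        rw [this]; exact hpt₁
    refine ⟨K.lassoR hj hv hcase hptm, T, ?_, hT⟩
    intro i hi
    change i ∈ (K.edgesR j v b (m + 1) ∪ K.edgesR j v b' (m + 1)).image Prod.fst at hi
    rw [Finset.image_union] at hi
    rcases Finset.mem_union.1 hi with hi | hi
    · have := K.image_fst_edgesR_subset (b := b) hs₁t hi
      rw [Finset.mem_insert] at this ⊢
      exact this.imp id fun h => Finset.mem_union_left _ h
    · have := K.image_fst_edgesR_subset (b := b') hs₁t hi
      rw [Finset.mem_insert] at this ⊢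
      exact this.imp id fun h => Finset.mem_union_right _ h
  · -- merge at a point, in different scopes
    have hpt : (K.st j v b s₁).2 = (K.st j v b' s₁).2 := hms₁.resolve_left hcase
    refine ⟨K.lassoV hj hv hpt hcase, T, ?_, hT⟩
    intro i hi
    change i ∈ (K.edgesV j v b s₁ ∪ K.edgesV j v b' s₁).image Prod.fst at hi
    rw [Finset.image_union] at hi
    rcases Finset.mem_union.1 hi with hi | hi
    · have := K.image_fst_edgesV_subset (b := b) hs₁t hi
      rw [Finset.mem_insert] at this ⊢
      exact this.imp id fun h => Finset.mem_union_left _ h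
    · have := K.image_fst_edgesV_subset (b := b') hs₁t hi
      rw [Finset.mem_insert] at this ⊢
      exact this.imp id fun h => Finset.mem_union_right _ h

end LassoKit

/-! ### Three lassos give an over-shared subfamily -/

/-- **Double counting an incidence set with all degrees `≥ 2` and degree `≥ 3` at `j`.** If `U`
is a set of incidences in which every point and every index other than `j` has a companion and
`j` carries three incidences, then its index set `F` satisfies
`2 |F| + 1 ≤ ∑_{w : deg_F w ≥ 2} deg_F w`. [folklore] -/
theorem overShared_of_companions {U : Finset (ι × ℕ)} {j : ι}
    (hincid : ∀ e ∈ U, e.2 ∈ S e.1)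
    (hrow : ∀ e ∈ U, e.1 ≠ j → ∃ e' ∈ U, e' ≠ e ∧ e'.1 = e.1)
    (hpt : ∀ e ∈ U, ∃ e' ∈ U, e' ≠ e ∧ e'.2 = e.2) (hj : 3 ≤ rowDeg U j) :
    2 * (U.image Prod.fst).card + 1 ≤
      ∑ w ∈ (cover S (U.image Prod.fst)).filter
        (fun w => 2 ≤ coverDegree S (U.image Prod.fst) w), coverDegree S (U.image Prod.fst) w := by
  classical
  set F := U.image Prod.fst with hF
  -- counting `U` by indices
  have hjF : j ∈ F := by
    have : (U.filter fun e => e.1 = j).Nonempty := Finset.card_pos.1 (by unfold rowDeg at hj; omega)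
    obtain ⟨e, he⟩ := this
    rw [Finset.mem_filter] at he
    exact Finset.mem_image.2 ⟨e, he.1, he.2⟩
  have hUrow : U.card = ∑ i ∈ F, rowDeg U i := Finset.card_eq_sum_card_image Prod.fst U
  have hrow2 : ∀ i ∈ F, 2 + (if i = j then 1 else 0) ≤ rowDeg U i := by
    intro i hi
    by_cases hij : i = j
    · rw [if_pos hij, hij]; exact hj
    · rw [if_neg hij, add_zero]
      obtain ⟨e, he, rfl⟩ := Finset.mem_image.1 hi
      obtain ⟨e', he', hne, h1⟩ := hrow e he hij
      exact two_le_rowDeg he he' hne.symm h1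
  have hlow : 2 * F.card + 1 ≤ U.card := by
    rw [hUrow]
    calc 2 * F.card + 1 = ∑ i ∈ F, (2 + if i = j then 1 else 0) := by
          rw [Finset.sum_add_distrib, Finset.sum_const, smul_eq_mul, mul_comm,
            Finset.sum_ite_eq' F j, if_pos hjF]
      _ ≤ ∑ i ∈ F, rowDeg U i := Finset.sum_le_sum hrow2
  -- counting `U` by points
  set W := U.image Prod.snd with hW
  have hUpt : U.card = ∑ w ∈ W, ptDeg U w := Finset.card_eq_sum_card_image Prod.snd U
  have hptdeg : ∀ w ∈ W, ptDeg U w ≤ coverDegree S F w := by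
    intro w hw
    unfold ptDeg coverDegree
    refine Finset.card_le_card_of_injOn Prod.fst (fun e he => ?_) (fun e he e' he' h => ?_)
    · have he' := Finset.mem_filter.1 (Finset.mem_coe.1 he)
      refine Finset.mem_coe.2 (Finset.mem_filter.2 ⟨Finset.mem_image_of_mem _ he'.1, ?_⟩)
      rw [← he'.2]; exact hincid e he'.1
    · have h2 := (Finset.mem_filter.1 (Finset.mem_coe.1 he)).2
      have h2' := (Finset.mem_filter.1 (Finset.mem_coe.1 he')).2
      exact Prod.ext h (h2.trans h2'.symm)
  have hpt2 : ∀ w ∈ W, 2 ≤ ptDeg U w := by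
    intro w hw
    obtain ⟨e, he, rfl⟩ := Finset.mem_image.1 hw
    obtain ⟨e', he', hne, h2⟩ := hpt e he
    exact two_le_ptDeg he he' hne.symm h2
  have hWsub : W ⊆ (cover S F).filter fun w => 2 ≤ coverDegree S F w := by
    intro w hw
    rw [Finset.mem_filter]
    refine ⟨?_, (hpt2 w hw).trans (hptdeg w hw)⟩
    obtain ⟨e, he, rfl⟩ := Finset.mem_image.1 hw
    exact mem_cover.2 ⟨e.1, Finset.mem_image_of_mem _ he, hincid e he⟩
  calc 2 * F.card + 1 ≤ U.card := hlow
    _ = ∑ w ∈ W, ptDeg U w := hUpt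
    _ ≤ ∑ w ∈ W, coverDegree S F w := Finset.sum_le_sum hptdeg
    _ ≤ _ := Finset.sum_le_sum_of_subset hWsub

/-- **Three lassos.** The union of lassos through three distinct points `v₁, v₂, v₃` of `S j` has
an over-shared index set. [folklore] -/
theorem overShared_of_three_lassos {j : ι} {v₁ v₂ v₃ : ℕ} (h12 : v₁ ≠ v₂) (h13 : v₁ ≠ v₃)
    (h23 : v₂ ≠ v₃) (L₁ : Lasso S J j v₁) (L₂ : Lasso S J j v₂) (L₃ : Lasso S J j v₃) :
    2 * ((L₁.U ∪ L₂.U ∪ L₃.U).image Prod.fst).card + 1 ≤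
      ∑ w ∈ (cover S ((L₁.U ∪ L₂.U ∪ L₃.U).image Prod.fst)).filter
        (fun w => 2 ≤ coverDegree S ((L₁.U ∪ L₂.U ∪ L₃.U).image Prod.fst) w),
        coverDegree S ((L₁.U ∪ L₂.U ∪ L₃.U).image Prod.fst) w := by
  classical
  have h1 : L₁.U ⊆ L₁.U ∪ L₂.U ∪ L₃.U := Finset.subset_union_left.trans Finset.subset_union_left
  have h2 : L₂.U ⊆ L₁.U ∪ L₂.U ∪ L₃.U := Finset.subset_union_right.trans Finset.subset_union_left
  have h3 : L₃.U ⊆ L₁.U ∪ L₂.U ∪ L₃.U := Finset.subset_union_right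
  refine overShared_of_companions (j := j) ?_ ?_ ?_ ?_
  · intro e he
    simp only [Finset.mem_union] at he
    rcases he with (he | he) | he
    · exact (L₁.incid e he).2
    · exact (L₂.incid e he).2
    · exact (L₃.incid e he).2
  · intro e he hne
    simp only [Finset.mem_union] at he
    rcases he with (he | he) | he
    · obtain ⟨e', he', h1', h2'⟩ := L₁.row e he hne; exact ⟨e', h1 he', h1', h2'⟩
    · obtain ⟨e', he', h1', h2'⟩ := L₂.row e he hne; exact ⟨e', h2 he', h1', h2'⟩
    · obtain ⟨e', he', h1', h2'⟩ := L₃.row e he hne; exact ⟨e', h3 he', h1', h2'⟩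
  · intro e he
    simp only [Finset.mem_union] at he
    rcases he with (he | he) | he
    · obtain ⟨e', he', h1', h2'⟩ := L₁.pt e he; exact ⟨e', h1 he', h1', h2'⟩
    · obtain ⟨e', he', h1', h2'⟩ := L₂.pt e he; exact ⟨e', h2 he', h1', h2'⟩
    · obtain ⟨e', he', h1', h2'⟩ := L₃.pt e he; exact ⟨e', h3 he', h1', h2'⟩
  · unfold rowDeg
    have hsub : ({(j, v₁), (j, v₂), (j, v₃)} : Finset (ι × ℕ)) ⊆
        (L₁.U ∪ L₂.U ∪ L₃.U).filter fun e => e.1 = j := by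
      intro e he
      simp only [Finset.mem_insert, Finset.mem_singleton] at he
      rw [Finset.mem_filter]
      rcases he with rfl | rfl | rfl
      · exact ⟨h1 L₁.mem, rfl⟩
      · exact ⟨h2 L₂.mem, rfl⟩
      · exact ⟨h3 L₃.mem, rfl⟩
    have hcard : ({(j, v₁), (j, v₂), (j, v₃)} : Finset (ι × ℕ)).card = 3 := by
      rw [Finset.card_insert_of_notMem, Finset.card_pair]
      · simpa using h23
      · simp [h12, h13]
    exact hcard ▸ Finset.card_le_card hsub

/-- **Boundaryless families contain small over-shared subfamilies.** If `J` is nonempty, every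
point of a scope of `J` lies in a second scope of `J`, the scopes of `J` have `≥ 3` points and
`|cover J| < 2^t`, then some `F` with at most `6 t + 1` indices is over-shared:
`2 |F| + 1 ≤ ∑_{w : deg_F w ≥ 2} deg_F w`. [folklore] -/
theorem exists_overShared_of_boundary_eq_empty (hJ : J.Nonempty)
    (hcl : ∀ i ∈ J, ∀ w ∈ S i, ∃ i' ∈ J, i' ≠ i ∧ w ∈ S i') (h3 : ∀ i ∈ J, 3 ≤ (S i).card)
    {t : ℕ} (ht : (cover S J).card < 2 ^ t) :
    ∃ F : Finset ι, F.card ≤ 6 * t + 1 ∧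
      2 * F.card + 1 ≤ ∑ w ∈ (cover S F).filter (fun w => 2 ≤ coverDegree S F w),
        coverDegree S F w := by
  classical
  obtain ⟨K⟩ := nonempty_lassoKit hcl h3
  obtain ⟨j, hj⟩ := hJ
  obtain ⟨v₁, hv₁, v₂, hv₂, v₃, hv₃, h12, h13, h23⟩ := Finset.two_lt_card.1 (h3 j hj)
  obtain ⟨L₁, T₁, hUT₁, hT₁⟩ := K.exists_lasso hj hv₁ ht
  obtain ⟨L₂, T₂, hUT₂, hT₂⟩ := K.exists_lasso hj hv₂ ht
  obtain ⟨L₃, T₃, hUT₃, hT₃⟩ := K.exists_lasso hj hv₃ ht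
  refine ⟨(L₁.U ∪ L₂.U ∪ L₃.U).image Prod.fst, ?_, overShared_of_three_lassos h12 h13 h23 L₁ L₂ L₃⟩
  have hsub : (L₁.U ∪ L₂.U ∪ L₃.U).image Prod.fst ⊆ insert j (T₁ ∪ T₂ ∪ T₃) := by
    rw [Finset.image_union, Finset.image_union]
    intro i hi
    simp only [Finset.mem_union] at hi
    rw [Finset.mem_insert, Finset.mem_union, Finset.mem_union]
    rcases hi with (hi | hi) | hi
    · have := hUT₁ hi; rw [Finset.mem_insert] at this; tauto
    · have := hUT₂ hi; rw [Finset.mem_insert] at this; tauto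
    · have := hUT₃ hi; rw [Finset.mem_insert] at this; tauto
  calc ((L₁.U ∪ L₂.U ∪ L₃.U).image Prod.fst).card ≤ (insert j (T₁ ∪ T₂ ∪ T₃)).card :=
        Finset.card_le_card hsub
    _ ≤ (T₁ ∪ T₂ ∪ T₃).card + 1 := Finset.card_insert_le _ _
    _ ≤ 6 * t + 1 := by
        have h := (Finset.card_union_le (T₁ ∪ T₂) T₃).trans
          (Nat.add_le_add_right (Finset.card_union_le T₁ T₂) _)
        omega

end Lasso

end Summit.PneNP.PneNP.Theorems
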